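import Mathlib
import HarnessLib
import Summits.Ventures.LatticeQCDFlow.Scaling.AutoregressiveGaugeRedundancyForest
import Summits.Ventures.LatticeQCDFlow.Scaling.AutoregressiveGaugePlaquetteReads

/-!
# LatticeQCDFlow / Scaling — THE VOLUME LAW FOR CONTEXT-FREE PROPOSALS: an exact sampler whose proposal
# draws the gauge links independently is rejected exponentially in the number of links of any forest,
# `ā ≤ (∏_{a ∈ T} ∫√q_a dHaar)² ≤ exp(−Σ_{a∈T} ∫(1 − √q_a)² dHaar)` — every gauge group, every coupling

HONEST FRAMING: exact (Metropolis-corrected) sampling algorithms for lattice gauge theory;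
figures of merit are autocorrelation/cost numbers at stated couplings and volumes; no
continuum-physics claim.

Venture `LatticeQCDFlow` (cell pub-lqcd), topic `Scaling`, FANOUT row 30 (lean-1, GEN-19) — OUR WORK on
THEORY-2.md §4 (how the cost of an EXACT sampler scales with the VOLUME), built on GEN-15's
`Scaling/AutoregressiveGaugeRedundancyForest` (THE LINKS OF A FOREST ARE JOINTLY HAAR under every
lattice gauge theory: `coordAvg_forest_eq_integral`) and GEN-15 II's total-mass identity
(`integral_coordAvg_eq`).

## What is proved (all [ours])

* §1 (general) **`meanAccept_le_sq_integral_sqrt`** — `ā = ∫∫ min(p(x)Q(y), p(y)Q(x)) ≤ (∫ √(pQ))²`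
  (non-negative bounded measurable `p`, `Q`, finite measure); **`coordAvg_sqrt_mul_le`** — Cauchy–Schwarz
  along the integrated coordinates `A_s √(fg) ≤ √(A_s f · A_s g)`; `coordAvg_prod_single`; `sqrt_prod_eq`;
  `integral_sqrt_eq_one_sub` — `∫√q = 1 − ½∫(1 − √q)²` for a probability density `q`.
* §2 (gauge configurations on `(ℤ/L)^d`, compact `G`, Haar; ANY gauge-invariant bounded measurable
  `F ≥ 0` with `Z = ∫F > 0`; ANY pruning certificate `T` = any forest of links, `s = (links of T)ᶜ`):
  **`forest_meanAccept_le_sq_integral_sqrt_coordAvg`** — for EVERY bounded measurable proposal density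
  `Q ≥ 0`: `ā(F/Z, Q) ≤ (∫ √(A_s Q) dπ)²`, the squared affinity between the FLAT law and the proposal's
  forest marginal (the target's forest marginal is flat); **`forest_meanAccept_le_prod_sq`** — for a
  CONTEXT-FREE proposal `Q(U) = ∏_a q_a(U_a)`: `ā ≤ (∏_{a∈T} ∫√q_a dHaar)²`;
  **`forest_meanAccept_le_exp_neg_sum`** — `ā ≤ exp(−Σ_{a∈T} ∫(1 − √q_a)² dHaar)`.

READING (value-free): a spanning tree of `(ℤ/L)^d` has `L^d − 1` links, so a proposal drawing the links
independently from one-link laws at squared Hellinger distance `≥ h²` from Haar is accepted at rate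
`≤ e^{−2(L^d − 1)h²}` — EXPONENTIALLY SMALL IN THE VOLUME, every compact gauge group, dimension, coupling;
the flat proposal (`h = 0`) is exponentially rejected by the tree's `Scaling/CouplingOverlap` instead.  Any
structure a proposal puts on the links of a forest is pure loss.  NOT CLAIMED: proposals with context (the
cell's other files); autocorrelations.  No `def`, no `sorry`, nothing cited as a fact.
-/

noncomputable section

namespace Summit.Ventures.LatticeQCDFlow.Theory2.Autoregressive

open MeasureTheory Function Set
open Literature.MathematicalPhysics.QuantumFieldTheory
open Summit.Ventures.LatticeQCDFlow.Exactness

/-! ## §1 General tools -/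

section General

/-- Bounded measurable functions are integrable for a finite measure. [folklore] -/
theorem integrable_of_bounded_measurable {Ω : Type*} [MeasurableSpace Ω] {ν : Measure Ω} [IsFiniteMeasure ν]
    {h : Ω → ℝ} (hm : Measurable h) {C : ℝ} (hb : ∀ x, |h x| ≤ C) : Integrable h ν :=
  Integrable.mono' (integrable_const C) hm.aestronglyMeasurable
    (ae_of_all _ fun x => by rw [Real.norm_eq_abs]; exact hb x)

/-- **`ā ≤ BC²`**: for non-negative bounded measurable `p`, `Q` on a finite measure space,
`∫∫ min(p(x)Q(y), p(y)Q(x)) ≤ (∫ √(p·Q))²` (pointwise `min(u, w) ≤ √(uw)`, then Fubini). [ours] -/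
theorem meanAccept_le_sq_integral_sqrt {Ω : Type*} [MeasurableSpace Ω] (ν : Measure Ω) [IsFiniteMeasure ν]
    {p Q : Ω → ℝ} (hp0 : ∀ x, 0 ≤ p x) (hpm : Measurable p) {Cp : ℝ} (hpb : ∀ x, p x ≤ Cp)
    (hQ0 : ∀ x, 0 ≤ Q x) (hQm : Measurable Q) {CQ : ℝ} (hQb : ∀ x, Q x ≤ CQ) :
    ∫ x, ∫ y, min (p x * Q y) (p y * Q x) ∂ν ∂ν ≤ (∫ x, Real.sqrt (p x * Q x) ∂ν) ^ 2 := by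
  set φ : Ω → ℝ := fun x => Real.sqrt (p x * Q x) with hφ
  have hφm : Measurable φ := (hpm.mul hQm).sqrt
  have hφ0 : ∀ x, 0 ≤ φ x := fun x => Real.sqrt_nonneg _
  have hbd : ∀ {f : Ω → ℝ} (_ : Measurable f) {C : ℝ} (_ : ∀ x, |f x| ≤ C), Integrable f ν :=
    fun hf C hC => integrable_of_bounded_measurable hf hC
  have hφb : ∀ x, |φ x| ≤ Real.sqrt (|Cp| * |CQ|) := fun x => by
    rw [abs_of_nonneg (hφ0 x)]
    exact Real.sqrt_le_sqrt (mul_le_mul ((hpb x).trans (le_abs_self _)) ((hQb x).trans (le_abs_self _))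
      (hQ0 x) (abs_nonneg _))
  have hφi : Integrable φ ν := hbd hφm hφb
  -- pointwise
  have hpt : ∀ x y, min (p x * Q y) (p y * Q x) ≤ φ x * φ y := by
    intro x y
    have hu : 0 ≤ p x * Q y := mul_nonneg (hp0 x) (hQ0 y)
    have hw : 0 ≤ p y * Q x := mul_nonneg (hp0 y) (hQ0 x)
    have e : φ x * φ y = Real.sqrt ((p x * Q y) * (p y * Q x)) := by
      rw [hφ]; dsimp only; rw [← Real.sqrt_mul (mul_nonneg (hp0 x) (hQ0 x))]; congr 1; ring
    rw [e]
    rcases le_total (p x * Q y) (p y * Q x) with h | h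
    · rw [min_eq_left h]
      calc p x * Q y = Real.sqrt ((p x * Q y) * (p x * Q y)) := by rw [Real.sqrt_mul_self hu]
        _ ≤ Real.sqrt ((p x * Q y) * (p y * Q x)) := Real.sqrt_le_sqrt (mul_le_mul_of_nonneg_left h hu)
    · rw [min_eq_right h]
      calc p y * Q x = Real.sqrt ((p y * Q x) * (p y * Q x)) := by rw [Real.sqrt_mul_self hw]
        _ ≤ Real.sqrt ((p x * Q y) * (p y * Q x)) := Real.sqrt_le_sqrt (mul_le_mul_of_nonneg_right h hw)
  -- integrate
  have e2 : (∫ x, φ x ∂ν) ^ 2 = ∫ x, ∫ y, φ x * φ y ∂ν ∂ν := by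
    simp_rw [integral_const_mul]; rw [integral_mul_const, sq]
  rw [e2]
  have hmin_m : Measurable fun z : Ω × Ω => min (p z.1 * Q z.2) (p z.2 * Q z.1) :=
    ((hpm.comp measurable_fst).mul (hQm.comp measurable_snd)).min
      ((hpm.comp measurable_snd).mul (hQm.comp measurable_fst))
  have hmin_b : ∀ x y, |min (p x * Q y) (p y * Q x)| ≤ |Cp| * |CQ| := fun x y => by
    rw [abs_of_nonneg (le_min (mul_nonneg (hp0 x) (hQ0 y)) (mul_nonneg (hp0 y) (hQ0 x)))]
    exact (min_le_left _ _).trans (mul_le_mul ((hpb x).trans (le_abs_self _))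
      ((hQb y).trans (le_abs_self _)) (hQ0 y) (abs_nonneg _))
  have hin_m : Measurable fun x => ∫ y, min (p x * Q y) (p y * Q x) ∂ν :=
    (hmin_m.stronglyMeasurable.integral_prod_right (ν := ν)).measurable
  have hin_b : ∀ x, |∫ y, min (p x * Q y) (p y * Q x) ∂ν| ≤ |Cp| * |CQ| * (ν Set.univ).toReal := fun x => by
    refine (abs_integral_le_integral_abs).trans ?_
    calc ∫ y, |min (p x * Q y) (p y * Q x)| ∂ν ≤ ∫ _, |Cp| * |CQ| ∂ν :=
          integral_mono (hbd (hmin_m.comp (measurable_const.prodMk measurable_id)).abs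
            (fun y => by rw [abs_abs]; exact hmin_b x y)) (integrable_const _) (fun y => hmin_b x y)
      _ = |Cp| * |CQ| * (ν Set.univ).toReal := by
          rw [integral_const, smul_eq_mul, Measure.real, mul_comm]
  refine integral_mono (hbd hin_m hin_b) ?_ (fun x => ?_)
  · exact (hφi.mul_const _).congr (ae_of_all _ fun x => (integral_const_mul (φ x) φ).symm)
  · show ∫ y, min (p x * Q y) (p y * Q x) ∂ν ≤ ∫ y, φ x * φ y ∂ν
    exact integral_mono (hbd (hmin_m.comp (measurable_const.prodMk measurable_id)) (fun y => hmin_b x y))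
      (hφi.const_mul _) (fun y => hpt x y)

variable {ι : Type*} [Fintype ι] [DecidableEq ι] {X : Type*} [MeasurableSpace X]
variable (μ : Measure X) [IsProbabilityMeasure μ]

/-- **Cauchy–Schwarz along the integrated coordinates**: for non-negative bounded measurable `f`, `g`,
`A_s √(f·g) ≤ √(A_s f · A_s g)` (the quadratic `t ↦ A_s (t√f − √g)² ≥ 0` has non-positive
discriminant). [ours] -/
theorem coordAvg_sqrt_mul_le (s : Finset ι) {f g : (ι → X) → ℝ} (hfm : Measurable f) (hf0 : ∀ ω, 0 ≤ f ω)
    {Cf : ℝ} (hfb : ∀ ω, f ω ≤ Cf) (hgm : Measurable g) (hg0 : ∀ ω, 0 ≤ g ω) {Cg : ℝ} (hgb : ∀ ω, g ω ≤ Cg)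
    (ω : ι → X) :
    coordAvg μ s (fun η => Real.sqrt (f η * g η)) ω ≤ Real.sqrt (coordAvg μ s f ω * coordAvg μ s g ω) := by
  have hbd : ∀ {h : (ι → X) → ℝ} (_ : Measurable h) {C : ℝ} (_ : ∀ η, |h η| ≤ C),
      Integrable (fun ω' : ι → X => h (s.piecewise ω' ω)) (Measure.pi fun _ : ι => μ) :=
    fun hh C hC => integrable_of_bounded_measurable
      (hh.comp ((measurable_piecewise_prod s).comp (measurable_const.prodMk measurable_id))) (fun ω' => hC _)
  have hCf : 0 ≤ Cf := (hf0 ω).trans (hfb ω)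
  have hfabs : ∀ η, |f η| ≤ Cf := fun η => by rw [abs_of_nonneg (hf0 η)]; exact hfb η
  have hgabs : ∀ η, |g η| ≤ Cg := fun η => by rw [abs_of_nonneg (hg0 η)]; exact hgb η
  have hsm : Measurable fun η => Real.sqrt (f η * g η) := (hfm.mul hgm).sqrt
  have hsabs : ∀ η, |Real.sqrt (f η * g η)| ≤ Real.sqrt (Cf * Cg) := fun η => by
    rw [abs_of_nonneg (Real.sqrt_nonneg _)]
    exact Real.sqrt_le_sqrt (mul_le_mul (hfb η) (hgb η) (hg0 η) hCf)
  have hfi := hbd hfm hfabs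
  have hgi := hbd hgm hgabs
  have hsi := hbd hsm hsabs
  set A : ℝ := coordAvg μ s f ω with hA
  set B : ℝ := coordAvg μ s g ω with hB
  set S : ℝ := coordAvg μ s (fun η => Real.sqrt (f η * g η)) ω with hS
  have hS0 : 0 ≤ S := by rw [hS]; unfold coordAvg; exact integral_nonneg fun ω' => Real.sqrt_nonneg _
  -- the quadratic `A t² − 2 S t + B = A_s (t√f − √g)² ≥ 0`
  have hquad : ∀ t : ℝ, 0 ≤ A * (t * t) + (-2 * S) * t + B := by
    intro t
    have ept : ∀ η, (t * Real.sqrt (f η) - Real.sqrt (g η)) ^ 2 =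
        (t * t) * f η - 2 * t * Real.sqrt (f η * g η) + g η := by
      intro η
      rw [sub_sq, mul_pow, Real.sq_sqrt (hf0 η), Real.sq_sqrt (hg0 η), Real.sqrt_mul (hf0 η)]; ring
    have h0 : 0 ≤ ∫ ω', (t * Real.sqrt (f (s.piecewise ω' ω)) - Real.sqrt (g (s.piecewise ω' ω))) ^ 2
        ∂Measure.pi (fun _ : ι => μ) := integral_nonneg fun ω' => sq_nonneg _
    have hI1 : Integrable (fun ω' : ι → X => (t * t) * f (s.piecewise ω' ω)) (Measure.pi fun _ : ι => μ) :=
      hfi.const_mul _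
    have hI2 : Integrable (fun ω' : ι → X => 2 * t * Real.sqrt (f (s.piecewise ω' ω) * g (s.piecewise ω' ω)))
        (Measure.pi fun _ : ι => μ) := hsi.const_mul _
    have e : ∫ ω', (t * Real.sqrt (f (s.piecewise ω' ω)) - Real.sqrt (g (s.piecewise ω' ω))) ^ 2
        ∂Measure.pi (fun _ : ι => μ) = A * (t * t) + (-2 * S) * t + B := by
      have hI12 : Integrable (fun ω' : ι → X => (t * t) * f (s.piecewise ω' ω) -
          2 * t * Real.sqrt (f (s.piecewise ω' ω) * g (s.piecewise ω' ω))) (Measure.pi fun _ : ι => μ) :=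
        hI1.sub hI2
      simp_rw [ept]
      rw [integral_add hI12 hgi, integral_sub hI1 hI2, integral_const_mul, integral_const_mul, hA, hB, hS]
      unfold coordAvg; ring
    linarith
  have hdisc := discrim_le_zero hquad
  rw [discrim] at hdisc
  have hS2 : S ^ 2 ≤ A * B := by nlinarith
  calc S = Real.sqrt (S ^ 2) := (Real.sqrt_sq hS0).symm
    _ ≤ Real.sqrt (A * B) := Real.sqrt_le_sqrt hS2

/-- **Partial average of a product of one-coordinate factors**: with each `q_a` integrating to one,
`A_s (∏_a q_a(U_a)) (U) = ∏_{a ∉ s} q_a(U_a)`. [ours] -/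
theorem coordAvg_prod_single (s : Finset ι) {q : ι → X → ℝ} (hq1 : ∀ a, ∫ v, q a v ∂μ = 1) (U : ι → X) :
    coordAvg μ s (fun W => ∏ a, q a (W a)) U = ∏ a ∈ Finset.univ \ s, q a (U a) := by
  unfold coordAvg
  have e : ∀ ω' : ι → X, (∏ a, q a ((s.piecewise ω' U) a)) =
      (∏ a, (if a ∈ s then q a (ω' a) else 1)) * ∏ a ∈ Finset.univ \ s, q a (U a) := by
    intro ω'
    have h1 : (fun a => q a ((s.piecewise ω' U) a)) = s.piecewise (fun a => q a (ω' a)) (fun a => q a (U a)) := by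
      funext a
      by_cases ha : a ∈ s
      · simp [ha]
      · simp [ha]
    rw [show (∏ a, q a ((s.piecewise ω' U) a)) = ∏ a, (s.piecewise (fun a => q a (ω' a)) (fun a => q a (U a))) a
      from by rw [h1], Finset.prod_piecewise, Finset.prod_ite_mem, Finset.univ_inter]
  simp_rw [e]
  rw [integral_mul_const]
  have h2 : ∫ ω' : ι → X, ∏ a, (if a ∈ s then q a (ω' a) else 1) ∂Measure.pi (fun _ : ι => μ) = 1 := by
    have h3 := MeasureTheory.integral_fintype_prod_eq_prod (𝕜 := ℝ) (μ := fun _ : ι => μ)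
      (fun a (v : X) => if a ∈ s then q a v else (1 : ℝ))
    rw [h3]
    refine Finset.prod_eq_one fun a _ => ?_
    by_cases ha : a ∈ s
    · simp only [ha, if_true, hq1 a]
    · simp [ha]
  rw [h2, one_mul]

omit [DecidableEq ι] in
/-- `√(∏ f) = ∏ √f` for non-negative factors. [folklore] -/
theorem sqrt_prod_eq {α : Type*} (t : Finset α) {f : α → ℝ} (hf : ∀ a, 0 ≤ f a) :
    Real.sqrt (∏ a ∈ t, f a) = ∏ a ∈ t, Real.sqrt (f a) := by
  classical
  induction t using Finset.induction_on with
  | empty => simp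
  | @insert b t hb ih =>
    rw [Finset.prod_insert hb, Finset.prod_insert hb, Real.sqrt_mul (hf b), ih]

omit [Fintype ι] [DecidableEq ι] in
/-- **The Hellinger form of the affinity**: `∫ √q dμ = 1 − ½ ∫ (1 − √q)² dμ` for a bounded measurable
probability density `q` (`μ` a probability measure). [folklore] -/
theorem integral_sqrt_eq_one_sub {q : X → ℝ} (hqm : Measurable q) (hq0 : ∀ v, 0 ≤ q v) {Cq : ℝ}
    (hqb : ∀ v, q v ≤ Cq) (hq1 : ∫ v, q v ∂μ = 1) :
    ∫ v, Real.sqrt (q v) ∂μ = 1 - (1 / 2) * ∫ v, (1 - Real.sqrt (q v)) ^ 2 ∂μ := by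
  have hqabs : ∀ v, |q v| ≤ Cq := fun v => by rw [abs_of_nonneg (hq0 v)]; exact hqb v
  have hsabs : ∀ v, |Real.sqrt (q v)| ≤ Real.sqrt Cq := fun v => by
    rw [abs_of_nonneg (Real.sqrt_nonneg _)]; exact Real.sqrt_le_sqrt (hqb v)
  have hqi : Integrable q μ := integrable_of_bounded_measurable hqm hqabs
  have hsi : Integrable (fun v => Real.sqrt (q v)) μ := integrable_of_bounded_measurable hqm.sqrt hsabs
  have e : ∀ v, (1 - Real.sqrt (q v)) ^ 2 = 1 - 2 * Real.sqrt (q v) + q v := fun v => by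
    rw [sub_sq, one_pow, Real.sq_sqrt (hq0 v)]; ring
  have hIa : Integrable (fun v => (1 : ℝ) - 2 * Real.sqrt (q v)) μ := (integrable_const (1 : ℝ)).sub (hsi.const_mul 2)
  have hIb : Integrable (fun v => 2 * Real.sqrt (q v)) μ := hsi.const_mul 2
  simp_rw [e]
  rw [integral_add hIa hqi, integral_sub (integrable_const (1 : ℝ)) hIb, integral_const_mul, hq1,
    integral_const, smul_eq_mul, Measure.real, measure_univ, ENNReal.toReal_one, one_mul]
  ring

end General

/-! ## §2 Gauge configurations: the forest marginal of the target is flat -/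

section Gauge

variable {d L : ℕ} {G : Type*} [Group G] [TopologicalSpace G] [IsTopologicalGroup G] [CompactSpace G]
  [MeasurableSpace G] [BorelSpace G] [NeZero L]

/-- **`ā ≤ (affinity of the proposal's forest marginal with the flat law)²`**: gauge-invariant bounded
measurable `F ≥ 0` with `Z = ∫F dπ > 0`, a pruning certificate `T` (forest), `s = (links of T)ᶜ`, bounded
measurable proposal density `Q ≥ 0`: `∫∫ min((F(U)/Z)Q(V), (F(V)/Z)Q(U)) ≤ (∫ √(A_s Q) dπ)²`. [ours] -/
theorem forest_meanAccept_le_sq_integral_sqrt_coordAvg {F : GaugeConfig d L G → ℝ} (hF : IsGaugeInvariant F)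
    (hFm : Measurable F) (hF0 : ∀ U, 0 ≤ F U) {CF : ℝ} (hFb : ∀ U, F U ≤ CF)
    (hZ : 0 < ∫ U, F U ∂Measure.pi (fun _ : Edge d L => haarProbability G))
    (T : List (Edge d L × Site d L))
    (hinc : ∀ p ∈ T, (p.1.1 = p.2 ∨ p.1.1.shift p.1.2 = p.2) ∧ p.1.1 ≠ p.1.1.shift p.1.2)
    (hpw : T.Pairwise (fun p q => ¬ (q.1.1 = p.2 ∨ q.1.1.shift q.1.2 = p.2)))
    {Q : GaugeConfig d L G → ℝ} (hQm : Measurable Q) (hQ0 : ∀ U, 0 ≤ Q U) {CQ : ℝ} (hQb : ∀ U, Q U ≤ CQ) :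
    ∫ U, ∫ V, min
        (F U / (∫ W, F W ∂Measure.pi (fun _ : Edge d L => haarProbability G)) * Q V)
        (F V / (∫ W, F W ∂Measure.pi (fun _ : Edge d L => haarProbability G)) * Q U)
        ∂Measure.pi (fun _ : Edge d L => haarProbability G) ∂Measure.pi (fun _ : Edge d L => haarProbability G) ≤
      (∫ U, Real.sqrt (coordAvg (haarProbability G) (Finset.univ \ (T.map Prod.fst).toFinset) Q U)
        ∂Measure.pi (fun _ : Edge d L => haarProbability G)) ^ 2 := by
  set μ := haarProbability G with hμ
  set π := Measure.pi (fun _ : Edge d L => μ) with hπ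
  set Z : ℝ := ∫ W, F W ∂π with hZdef
  set s : Finset (Edge d L) := Finset.univ \ (T.map Prod.fst).toFinset with hs
  have hFabs : ∀ U, |F U| ≤ CF := fun U => by rw [abs_of_nonneg (hF0 U)]; exact hFb U
  -- target density `p = F/Z`
  have hpm : Measurable fun U => F U / Z := hFm.div_const Z
  have hp0 : ∀ U, 0 ≤ F U / Z := fun U => div_nonneg (hF0 U) hZ.le
  have hpb : ∀ U, F U / Z ≤ CF / Z := fun U => div_le_div_of_nonneg_right (hFb U) hZ.le
  -- (1) `ā ≤ (∫ √(pQ))²`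
  have h1 := meanAccept_le_sq_integral_sqrt π hp0 hpm hpb hQ0 hQm hQb
  -- (2) `∫ √(pQ) = ∫ A_s √(pQ) ≤ ∫ √(A_s p · A_s Q) = ∫ √(A_s Q)` (forest marginal of `p` is `1`)
  have hsqm : Measurable fun U => Real.sqrt (F U / Z * Q U) := (hpm.mul hQm).sqrt
  have hCQ : ∀ U : GaugeConfig d L G, 0 ≤ CQ := fun U => (hQ0 U).trans (hQb U)
  have hsqb : ∃ C, ∀ U, |Real.sqrt (F U / Z * Q U)| ≤ C := ⟨Real.sqrt (CF / Z * CQ), fun U => by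
    rw [abs_of_nonneg (Real.sqrt_nonneg _)]
    exact Real.sqrt_le_sqrt (mul_le_mul (hpb U) (hQb U) (hQ0 U) ((hp0 U).trans (hpb U)))⟩
  have h2 : ∫ U, Real.sqrt (F U / Z * Q U) ∂π = ∫ U, coordAvg μ s (fun W => Real.sqrt (F W / Z * Q W)) U ∂π :=
    (integral_coordAvg_eq μ s hsqm hsqb).symm
  have hAp : ∀ U, coordAvg μ s (fun W => F W / Z) U = 1 := fun U => by
    have e : coordAvg μ s (fun W => F W / Z) U = coordAvg μ s F U / Z := integral_div Z _
    rw [e, hs, coordAvg_forest_eq_integral hF hFm ⟨CF, hFabs⟩ T hinc hpw U, ← hZdef, div_self hZ.ne']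
  have h3 : ∀ U, coordAvg μ s (fun W => Real.sqrt (F W / Z * Q W)) U ≤ Real.sqrt (coordAvg μ s Q U) := by
    intro U
    have h := coordAvg_sqrt_mul_le μ s hpm hp0 hpb hQm hQ0 hQb U
    rwa [hAp U, one_mul] at h
  -- measurability / bounds for the comparison (tree `measurable_coordAvg`, `coordAvg_mem_Icc`)
  have hAQm : Measurable (coordAvg μ s Q) := measurable_coordAvg μ s hQm
  have hAQb : ∀ U, 0 ≤ coordAvg μ s Q U ∧ coordAvg μ s Q U ≤ CQ := fun U => coordAvg_mem_Icc μ s hQm hQ0 hQb U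
  have hAsm : Measurable (coordAvg μ s (fun W => Real.sqrt (F W / Z * Q W))) := measurable_coordAvg μ s hsqm
  obtain ⟨Cs, hCs⟩ := hsqb
  have hAsb : ∀ U, |coordAvg μ s (fun W => Real.sqrt (F W / Z * Q W)) U| ≤ Cs := fun U => by
    have h := coordAvg_mem_Icc μ s hsqm (fun W => Real.sqrt_nonneg _) (fun W => (le_abs_self _).trans (hCs W)) U
    rw [abs_of_nonneg h.1]; exact h.2
  have h4 : ∫ U, coordAvg μ s (fun W => Real.sqrt (F W / Z * Q W)) U ∂π ≤ ∫ U, Real.sqrt (coordAvg μ s Q U) ∂π :=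
    integral_mono (integrable_of_bounded_measurable hAsm hAsb) (integrable_of_bounded_measurable hAQm.sqrt
      (C := Real.sqrt CQ) (fun U => by
        rw [abs_of_nonneg (Real.sqrt_nonneg _)]; exact Real.sqrt_le_sqrt (hAQb U).2)) h3
  have h0 : 0 ≤ ∫ U, Real.sqrt (F U / Z * Q U) ∂π := integral_nonneg fun _ => Real.sqrt_nonneg _
  calc _ ≤ (∫ U, Real.sqrt (F U / Z * Q U) ∂π) ^ 2 := h1
    _ ≤ (∫ U, Real.sqrt (coordAvg μ s Q U) ∂π) ^ 2 :=
        pow_le_pow_left₀ h0 (h2.trans_le h4) 2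

/-- **CONTEXT-FREE PROPOSALS: `ā ≤ (∏_{a ∈ T} ∫ √q_a dHaar)²`** — the proposal draws the links
INDEPENDENTLY, `Q(U) = ∏_a q_a(U_a)`, one-link densities `q_a ≥ 0` bounded measurable, `∫q_a = 1`. [ours] -/
theorem forest_meanAccept_le_prod_sq {F : GaugeConfig d L G → ℝ} (hF : IsGaugeInvariant F)
    (hFm : Measurable F) (hF0 : ∀ U, 0 ≤ F U) {CF : ℝ} (hFb : ∀ U, F U ≤ CF)
    (hZ : 0 < ∫ U, F U ∂Measure.pi (fun _ : Edge d L => haarProbability G))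
    (T : List (Edge d L × Site d L))
    (hinc : ∀ p ∈ T, (p.1.1 = p.2 ∨ p.1.1.shift p.1.2 = p.2) ∧ p.1.1 ≠ p.1.1.shift p.1.2)
    (hpw : T.Pairwise (fun p q => ¬ (q.1.1 = p.2 ∨ q.1.1.shift q.1.2 = p.2)))
    {q : Edge d L → G → ℝ} (hqm : ∀ a, Measurable (q a)) (hq0 : ∀ a v, 0 ≤ q a v) {Cq : ℝ}
    (hqb : ∀ a v, q a v ≤ Cq) (hq1 : ∀ a, ∫ v, q a v ∂(haarProbability G) = 1) :
    ∫ U, ∫ V, min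
        (F U / (∫ W, F W ∂Measure.pi (fun _ : Edge d L => haarProbability G)) * ∏ a, q a (V a))
        (F V / (∫ W, F W ∂Measure.pi (fun _ : Edge d L => haarProbability G)) * ∏ a, q a (U a))
        ∂Measure.pi (fun _ : Edge d L => haarProbability G) ∂Measure.pi (fun _ : Edge d L => haarProbability G) ≤
      (∏ a ∈ (T.map Prod.fst).toFinset, ∫ v, Real.sqrt (q a v) ∂(haarProbability G)) ^ 2 := by
  classical
  set μ := haarProbability G with hμ
  set Tl : Finset (Edge d L) := (T.map Prod.fst).toFinset with hTl
  have hQm : Measurable fun U : GaugeConfig d L G => ∏ a, q a (U a) :=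
    Finset.measurable_prod _ fun a _ => (hqm a).comp (measurable_pi_apply a)
  have hQ0 : ∀ U : GaugeConfig d L G, 0 ≤ ∏ a, q a (U a) := fun U => Finset.prod_nonneg fun a _ => hq0 a _
  have hQb : ∀ U : GaugeConfig d L G, ∏ a, q a (U a) ≤ (max Cq 0) ^ Fintype.card (Edge d L) := fun U => by
    rw [← Finset.card_univ, ← Finset.prod_const]
    exact Finset.prod_le_prod (fun a _ => hq0 a _) (fun a _ => (hqb a _).trans (le_max_left _ _))
  have h := forest_meanAccept_le_sq_integral_sqrt_coordAvg hF hFm hF0 hFb hZ T hinc hpw hQm hQ0 hQb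
  -- the forest marginal of the product proposal and its affinity with the flat law
  have hmarg : ∀ U : GaugeConfig d L G, coordAvg μ (Finset.univ \ Tl) (fun W => ∏ a, q a (W a)) U =
      ∏ a ∈ Tl, q a (U a) := fun U => by
    rw [coordAvg_prod_single μ _ hq1 U, Finset.sdiff_sdiff_eq_self (Finset.subset_univ Tl)]
  have hsq : ∀ U : GaugeConfig d L G, Real.sqrt (∏ a ∈ Tl, q a (U a)) = ∏ a ∈ Tl, Real.sqrt (q a (U a)) :=
    fun U => sqrt_prod_eq Tl (fun a => hq0 a (U a))
  have hint : ∫ U, Real.sqrt (coordAvg μ (Finset.univ \ Tl) (fun W => ∏ a, q a (W a)) U)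
      ∂Measure.pi (fun _ : Edge d L => μ) = ∏ a ∈ Tl, ∫ v, Real.sqrt (q a v) ∂μ := by
    simp_rw [hmarg, hsq]
    have h3 := MeasureTheory.integral_fintype_prod_eq_prod (𝕜 := ℝ) (μ := fun _ : Edge d L => μ)
      (fun a (v : G) => if a ∈ Tl then Real.sqrt (q a v) else (1 : ℝ))
    have e1 : ∀ U : GaugeConfig d L G, (∏ a, (if a ∈ Tl then Real.sqrt (q a (U a)) else (1 : ℝ))) =
        ∏ a ∈ Tl, Real.sqrt (q a (U a)) := fun U => by
      rw [Finset.prod_ite_mem, Finset.univ_inter]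
    have e2 : (∏ a, ∫ v, (if a ∈ Tl then Real.sqrt (q a v) else (1 : ℝ)) ∂μ) =
        ∏ a ∈ Tl, ∫ v, Real.sqrt (q a v) ∂μ := by
      have e3 : ∀ a, (∫ v, (if a ∈ Tl then Real.sqrt (q a v) else (1 : ℝ)) ∂μ) =
          if a ∈ Tl then ∫ v, Real.sqrt (q a v) ∂μ else 1 := by
        intro a
        by_cases ha : a ∈ Tl
        · simp only [ha, if_true]
        · simp [ha]
      simp_rw [e3]
      rw [Finset.prod_ite_mem, Finset.univ_inter]
    simp_rw [e1] at h3
    rw [h3, e2]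
  rw [hint] at h
  exact h

/-- **THE VOLUME LAW**: `ā ≤ exp(−Σ_{a ∈ T} ∫ (1 − √q_a)² dHaar)` — each forest link whose proposal law is
at squared Hellinger distance `h_a² = ½∫(1 − √q_a)²` from Haar costs a factor `e^{−2h_a²}`; a spanning tree
of `(ℤ/L)^d` has `L^d − 1` links. [ours] -/
theorem forest_meanAccept_le_exp_neg_sum {F : GaugeConfig d L G → ℝ} (hF : IsGaugeInvariant F)
    (hFm : Measurable F) (hF0 : ∀ U, 0 ≤ F U) {CF : ℝ} (hFb : ∀ U, F U ≤ CF)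
    (hZ : 0 < ∫ U, F U ∂Measure.pi (fun _ : Edge d L => haarProbability G))
    (T : List (Edge d L × Site d L))
    (hinc : ∀ p ∈ T, (p.1.1 = p.2 ∨ p.1.1.shift p.1.2 = p.2) ∧ p.1.1 ≠ p.1.1.shift p.1.2)
    (hpw : T.Pairwise (fun p q => ¬ (q.1.1 = p.2 ∨ q.1.1.shift q.1.2 = p.2)))
    {q : Edge d L → G → ℝ} (hqm : ∀ a, Measurable (q a)) (hq0 : ∀ a v, 0 ≤ q a v) {Cq : ℝ}
    (hqb : ∀ a v, q a v ≤ Cq) (hq1 : ∀ a, ∫ v, q a v ∂(haarProbability G) = 1) :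
    ∫ U, ∫ V, min
        (F U / (∫ W, F W ∂Measure.pi (fun _ : Edge d L => haarProbability G)) * ∏ a, q a (V a))
        (F V / (∫ W, F W ∂Measure.pi (fun _ : Edge d L => haarProbability G)) * ∏ a, q a (U a))
        ∂Measure.pi (fun _ : Edge d L => haarProbability G) ∂Measure.pi (fun _ : Edge d L => haarProbability G) ≤
      Real.exp (-(∑ a ∈ (T.map Prod.fst).toFinset,
        ∫ v, (1 - Real.sqrt (q a v)) ^ 2 ∂(haarProbability G))) := by
  classical
  set μ := haarProbability G with hμ
  set Tl : Finset (Edge d L) := (T.map Prod.fst).toFinset with hTl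
  have h := forest_meanAccept_le_prod_sq hF hFm hF0 hFb hZ T hinc hpw hqm hq0 hqb hq1
  refine h.trans ?_
  -- `(∏ b_a)² = ∏ b_a²`, `b_a = 1 − H_a/2`, `(1 − H_a/2)² ≤ e^{−H_a}`
  have hb : ∀ a, ∫ v, Real.sqrt (q a v) ∂μ = 1 - (1 / 2) * ∫ v, (1 - Real.sqrt (q a v)) ^ 2 ∂μ :=
    fun a => integral_sqrt_eq_one_sub μ (hqm a) (hq0 a) (hqb a) (hq1 a)
  have hb0 : ∀ a, 0 ≤ ∫ v, Real.sqrt (q a v) ∂μ := fun a => integral_nonneg fun v => Real.sqrt_nonneg _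
  have hH0 : ∀ a, 0 ≤ ∫ v, (1 - Real.sqrt (q a v)) ^ 2 ∂μ := fun a => integral_nonneg fun v => sq_nonneg _
  rw [← Finset.prod_pow, ← Finset.sum_neg_distrib, Real.exp_sum]
  refine Finset.prod_le_prod (fun a _ => sq_nonneg _) (fun a _ => ?_)
  -- one factor
  have e : (∫ v, Real.sqrt (q a v) ∂μ) ^ 2 ≤ (1 - (1 / 2) * ∫ v, (1 - Real.sqrt (q a v)) ^ 2 ∂μ) ^ 2 := by
    rw [hb a]
  refine e.trans ?_
  set H : ℝ := ∫ v, (1 - Real.sqrt (q a v)) ^ 2 ∂μ with hH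
  have h1 : 0 ≤ 1 - (1 / 2) * H := by
    have := hb0 a; rw [hb a] at this; exact this
  have h2 : 1 - (1 / 2) * H ≤ Real.exp (-(H / 2)) := by
    have := Real.add_one_le_exp (-(H / 2)); linarith
  calc (1 - (1 / 2) * H) ^ 2 ≤ (Real.exp (-(H / 2))) ^ 2 := pow_le_pow_left₀ h1 h2 2
    _ = Real.exp (-H) := by rw [← Real.exp_nat_mul]; ring_nf

end Gauge

end Summit.Ventures.LatticeQCDFlow.Theory2.Autoregressive

end
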